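import Summits.ValiantsHypothesis.ValiantsHypothesis.Theorems.LacunarySymmetroidMatrixDescartesCensusFrame

/-!
# `MatrixDescartes` — census: the classical rows — column `K = 2` (`ζ(m,2) = m`) and size `m = 1` (`ζ(1,K) = K − 1`)

HONEST FRAMING.  Object-search cell `pub-symmetroid`; finite/classical rows of the census table, no bearing on the
asymptotic crux `Theses.LacunarySymmetroid.MatrixDescartes` (stmt-ValiantsHypothesis-18050), no `VP ≠ VNP` claim.
For every `m ≥ 1`: `ζ(m,2) = m` (`row_two : PosRootLawAt m 2 m ∧ ¬ PosRootLawAt m 2 (m − 1)`).  The `≤` half is the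
Descartes ceiling `C(m+1, m) − 1 = m` (tree `stub_descartesCeiling` via `posRootLawAt_descartes`); the `≥` half is
the diagonal witness `F = −diag(1, …, m) + X · 1`, `det F = ∏ (X − i)`, with the `m` positive zeros `1, …, m`.
With the currency theorem (`posRootLawAt_iff_realRootLawAt`, Currency file) this also gives `M(m,2) = 2m + 1`,
matching `realRootLawAt_two` of the Frame file.  And for every `K ≥ 2`: `ζ(1,K) = K − 1` (`row_one`), Descartes'
rule of signs and its sharpness (`∏_{i<K−1} (X − (i+1))` as a `1 × 1` pencil). [folklore]
-/

-- `Summit.ValiantsHypothesis.ValiantsHypothesis.…` repeats a component by the D-0017 layout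
-- (single-conjunct summit), which the `dupNamespace` linter flags; the name is mandated.
set_option linter.dupNamespace false

namespace Summit.ValiantsHypothesis.ValiantsHypothesis.Theorems.LacunarySymmetroidMatrixDescartes.Census

open Summit.ValiantsHypothesis.ValiantsHypothesis.Theorems.MatrixDescartes.Negative (PosRootLawAt)
open Summit.ValiantsHypothesis.ValiantsHypothesis.Theorems.SymmetroidDescartes (eval_det_pencil)
open scoped BigOperators Matrix
open Polynomial

/-- The evaluated diagonal witness `−diag(1,…,m) + t · diag(1,…,1)` is `diag(t − 1, …, t − m)`, so its
determinant is `∏ᵢ (t − (i+1))`. [folklore] -/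
theorem det_eval_diagWitness (m : ℕ) (t : ℝ) :
    (∑ l, t ^ (![0, 1] : Fin 2 → ℕ) l •
        (![-Matrix.diagonal (fun i : Fin m => ((i : ℕ) : ℝ) + 1), Matrix.diagonal (fun _ : Fin m => (1 : ℝ))] :
          Fin 2 → Matrix (Fin m) (Fin m) ℝ) l).det
      = ∏ i : Fin m, (t - (((i : ℕ) : ℝ) + 1)) := by
  rw [Fin.sum_univ_two]
  simp only [Matrix.cons_val_zero, Matrix.cons_val_one, pow_zero, one_smul, pow_one]
  have h : (-Matrix.diagonal (fun i : Fin m => ((i : ℕ) : ℝ) + 1) + t • Matrix.diagonal (fun _ : Fin m => (1 : ℝ)))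
      = Matrix.diagonal (fun i : Fin m => t - (((i : ℕ) : ℝ) + 1)) := by
    ext i j
    by_cases hij : i = j
    · subst hij
      simp [Matrix.diagonal]
      ring
    · simp [Matrix.diagonal, hij]
  rw [h, Matrix.det_diagonal]

/-- **Classical column `K = 2`: `ζ(m,2) = m` for every `m ≥ 1`.** [folklore] -/
theorem row_two (m : ℕ) (hm : 0 < m) : PosRootLawAt m 2 m ∧ ¬ PosRootLawAt m 2 (m - 1) := by
  classical
  refine ⟨?_, fun h => ?_⟩
  · have h := posRootLawAt_descartes m 2 (by norm_num)
    have hc : Nat.choose (m + 2 - 1) m - 1 = m := by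
      have e : m + 2 - 1 = m + 1 := by omega
      rw [e, Nat.choose_succ_self_right]
      omega
    rw [hc] at h
    exact h
  · -- the diagonal witness has the `m` positive zeros `1, …, m`
    set d : Fin 2 → ℕ := ![0, 1] with hd
    set S : Fin 2 → Matrix (Fin m) (Fin m) ℝ :=
      ![-Matrix.diagonal (fun i : Fin m => ((i : ℕ) : ℝ) + 1), Matrix.diagonal (fun _ : Fin m => (1 : ℝ))]
      with hS
    have hsymm : ∀ l, (S l).IsSymm := by
      intro l
      fin_cases l
      · simp [hS, Matrix.IsSymm]
      · simp [hS, Matrix.IsSymm]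
    have hZ := h d S hsymm
    -- the polynomial determinant is nonzero (its value at `0` is `∏ (−(i+1)) ≠ 0`)
    set p : ℝ[X] := (∑ l, (X : ℝ[X]) ^ d l • (S l).map Polynomial.C).det with hp
    have heval : ∀ t : ℝ, p.eval t = ∏ i : Fin m, (t - (((i : ℕ) : ℝ) + 1)) := by
      intro t
      rw [hp, eval_det_pencil, hd, hS]
      exact det_eval_diagWitness m t
    have hp0 : p ≠ 0 := by
      intro h0
      have h1 := heval 0
      rw [h0, Polynomial.eval_zero] at h1
      have hne : ∏ i : Fin m, ((0 : ℝ) - (((i : ℕ) : ℝ) + 1)) ≠ 0 :=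
        Finset.prod_ne_zero_iff.2 fun i _ => by
          have : (0 : ℝ) < ((i : ℕ) : ℝ) + 1 := by positivity
          linarith
      exact hne h1.symm
    -- inject `i ↦ i + 1` into the positive roots
    have hle : m ≤ (p.roots.toFinset.filter (fun t => 0 < t)).card := by
      calc m = (Finset.univ : Finset (Fin m)).card := by simp
        _ ≤ (p.roots.toFinset.filter (fun t => 0 < t)).card := by
          refine Finset.card_le_card_of_injOn (fun i : Fin m => ((i : ℕ) : ℝ) + 1) (fun i _ => ?_) ?_
          · simp only [Finset.mem_coe, Finset.mem_filter, Multiset.mem_toFinset, Polynomial.mem_roots hp0,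
              Polynomial.IsRoot.def, heval]
            exact ⟨Finset.prod_eq_zero (Finset.mem_univ i) (by ring), by positivity⟩
          · intro i _ j _ hij
            have : ((i : ℕ) : ℝ) = ((j : ℕ) : ℝ) := by simpa using hij
            exact Fin.ext (by exact_mod_cast this)
    have : (p.roots.toFinset.filter (fun t => 0 < t)).card ≤ m - 1 := hZ
    omega


/-- **Classical row `m = 1` (Descartes 1637, sharp): `ζ(1,K) = K − 1` for every `K ≥ 2`.**  The `≤` half is the
Descartes ceiling `C(K,1) − 1`; the `≥` half is the `K`-nomial `∏_{i<K−1} (X − (i+1))` (all `K` coefficients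
present or not — zero coefficients are allowed terms of the pencil), read as a `1 × 1` pencil with exponents
`0, …, K−1`, whose positive zeros are `1, …, K−1`. [folklore] -/
theorem row_one (K : ℕ) (hK : 2 ≤ K) : PosRootLawAt 1 K (K - 1) ∧ ¬ PosRootLawAt 1 K (K - 2) := by
  classical
  refine ⟨?_, fun h => ?_⟩
  · have h := posRootLawAt_descartes 1 K (by omega)
    have hc : Nat.choose (1 + K - 1) 1 - 1 = K - 1 := by
      rw [show 1 + K - 1 = K by omega, Nat.choose_one_right]
    rw [hc] at h
    exact h
  · set s : Finset ℝ := (Finset.range (K - 1)).image (fun i : ℕ => (i : ℝ) + 1) with hs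
    set p : ℝ[X] := ∏ a ∈ s, (X - C a) with hp
    have hscard : s.card = K - 1 := by
      rw [hs, Finset.card_image_of_injective _ (fun a b hab => by
        have hab' : (a : ℝ) + 1 = (b : ℝ) + 1 := hab
        exact_mod_cast (add_right_cancel hab')), Finset.card_range]
    have hdeg : p.natDegree = K - 1 := by
      have e := natDegree_finsetProd_X_sub_C_eq_card s (fun a : ℝ => a)
      rw [← hscard]
      exact e
    have hroots : p.roots = s.val := roots_prod_X_sub_C s
    have hS : ∀ l : Fin K, ((fun l : Fin K => !![p.coeff l]) l : Matrix (Fin 1) (Fin 1) ℝ).IsSymm := by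
      intro l
      unfold Matrix.IsSymm
      ext i j
      fin_cases i
      fin_cases j
      rfl
    have hdet : (∑ l, (X : ℝ[X]) ^ ((fun l : Fin K => (l : ℕ)) l) •
        ((fun l : Fin K => !![p.coeff l]) l).map Polynomial.C).det = p := by
      rw [Matrix.det_fin_one]
      simp only [Matrix.sum_apply, Matrix.smul_apply, Matrix.map_apply, smul_eq_mul, Matrix.of_apply,
        Matrix.cons_val_zero]
      rw [Fin.sum_univ_eq_sum_range (fun i => (X : ℝ[X]) ^ i * C (p.coeff i)) K]
      conv_rhs => rw [p.as_sum_range_C_mul_X_pow' (show p.natDegree < K by omega)]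
      exact Finset.sum_congr rfl fun i _ => mul_comm _ _
    have hZ := h (fun l : Fin K => (l : ℕ)) (fun l : Fin K => !![p.coeff l]) hS
    rw [hdet, hroots, Finset.val_toFinset] at hZ
    have hfilt : s.filter (fun t => 0 < t) = s := by
      apply Finset.filter_true_of_mem
      intro t ht
      obtain ⟨i, _, rfl⟩ := Finset.mem_image.1 ht
      positivity
    rw [hfilt, hscard] at hZ
    omega

end Summit.ValiantsHypothesis.ValiantsHypothesis.Theorems.LacunarySymmetroidMatrixDescartes.Census
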